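import Literature.NumberTheory.QuadraticForms.HasseNormTheoremHolds
import Literature.NumberTheory.QuadraticForms.HilbertSymbolArchimedean
import Literature.NumberTheory.QuadraticForms.HasseMinkowskiTernaryLemmas
import Literature.NumberTheory.NumberFields.CMFieldTotallyNegativeGenerator
import HarnessLib

/-!
# The Hasse norm theorem for a CM field over its maximal totally real subfield: a totally positive
# `b ∈ F` which is a local norm from `E` at every finite prime is `e · ē` (Milne, *Complex
# Multiplication*, proof of Lemma 9.14; Milne 2007, proof of Thm. 3.10 / Lemma 3.12)

Topic `NumberTheory/NumberFields` (CM fields); namespace `Literature.NumberTheory.NumberFields`.  Lane `lit-hodgefound`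
(Track 2, Layer A3 skeleton seat `skel-3`, row A3-G43 FILE 1: the HASSE-NORM STEP of the number-theoretic core of the
proof of the fundamental theorem of complex multiplication over the reflex field).  THEOREMS ONLY, all proved; no
definition, no named fact (D-0026, net debt 0).

## The print, verbatim

J. S. Milne, *Complex Multiplication* (version July 14, 2020), Ch. II §9, proof of LEMMA 9.14 (p. 79; cached text
`paper:url-8ccc30e4daab` p0079 L49–L54) — identical words in J. S. Milne, *The fundamental theorem of complex
multiplication*, arXiv:0705.3446, §3.4, proof of Thm. 3.10 after Lemma 3.12 (held `paper:arxiv-0705.3446` p0017 L10–L18):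

> «Let `t = η(σ)/N_Φ(s)`. Then `t · t̄ = 1/ac ∈ F_{≫0}`. (68)  Being a totally positive element of `F`, `ac` is a local
> norm from `E` at the infinite primes, and (68) shows that it is also a local norm at the finite primes. Therefore we
> can write `ac = e · ē` for some `e ∈ E^×`. Then `te · \overline{te} = 1`.»

Here `E` is a CM field, `F` its largest totally real subfield, `ē = ι_E e`.  «Therefore» is HASSE'S NORM THEOREM for the
quadratic (cyclic) extension `E/F` — an element of `F^×` which is a local norm from `E` at every prime of `F` is a global
norm — which the tree PROVES for every quadratic extension `K(√a)/K` of number fields in Hilbert-symbol form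
(`Literature.NumberTheory.Automorphic.hilbertSymbol_eq_one_of_forall_completions_holds`, O'Meara 65:23 = Vignéras III
Cor. 3.4, `…QuadraticForms/HasseNormTheoremHolds`).  This file is the TRANSLATION to `E/F` with its complex conjugation:
`E = F(α)` with `ᾱ = -α`, `α² = θ ∈ F` not a square and totally negative (`…NumberFields/CMFieldTotallyNegativeGenerator`),
`N_{E/F}(x + yα) = (x + yα)(x - yα) = x² - θy²`, so «`b` is a norm from `E`» is `(θ, b)_F = 1` and «`b` is a local norm
at `v`» is `(θ, b)_{F_v} = 1` (O'Meara 63:10, the tree's `hilbertSymbol_eq_one_iff_exists_norm`); at a real place `v`,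
`θ <_v 0`, so `(θ, b)_v = 1 ↔ b >_v 0` («being totally positive, a local norm at the infinite primes»).

## Main statements (`L` a CM field, `L⁺ = maximalRealSubfield L`, `ῑ = IsCMField.complexConj L`)

* §1 the norm form: `add_mul_mul_complexConj_add_mul` (`(x + yα)·ῑ(x + yα) = x² - θy²`), `exists_eq_add_mul`
  (every `e ∈ L` is `x + yα`, `x, y ∈ L⁺`), `exists_eq_mul_complexConj_iff_exists_sq_sub_mul_sq`
  (`b = e·ē` for some `e` `↔ ∃ x y ∈ L⁺, x² - θy² = b`) = `↔ (θ, b)_{L⁺} = 1`.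
* §2 **`IsCMField.exists_eq_mul_complexConj_of_forall_isLocalNorm`** — THE HASSE-NORM STEP: `b ∈ L⁺` positive at every
  real place and with `x² - θy² = b` soluble in `L⁺_v` for every finite `v` is `e · ē`, `e ∈ L`; the variants with
  `∀ φ : L⁺ →+* ℝ, 0 < φ b`, with Hilbert symbols, and for `b ∈ L` with `b̄ = b`.

NOT HERE (row A3-G43 FILE 2 / Layer B): «(68) shows that it is also a local norm at the finite primes» — the passage from
`b = t · ι_E t`, `t ∈ 𝔸^×_{f,E}`, to the finite local conditions (finite-adelic base change `𝔸_{f,E} = 𝔸_{f,F} ⊕ α𝔸_{f,F}`);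
Lemma 9.14 / 3.12 themselves, (63)–(67), Theorem 9.10.

## References

* J. S. Milne, *Complex Multiplication* (2006; version July 14, 2020), Ch. II §9, Lemma 9.14 and its proof (p. 79). [MilneCM2006]
* J. S. Milne, *The fundamental theorem of complex multiplication*, arXiv:0705.3446 (2007), §3.4, Lemma 3.12 and the
  proof of Thm. 3.10. [Milne2007FundamentalCM]
* O. T. O'Meara, *Introduction to Quadratic Forms* (1963), §63B (63:10), §65D Thm. 65:23 (Hasse norm theorem). [Omeara1963]
* M.-F. Vignéras, *Arithmétique des algèbres de quaternions*, LNM 800 (1980), Ch. III §3 Cor. 3.4. [VignerasLNM800]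
* J. Neukirch, *Algebraic Number Theory* (1999), Ch. VI §4 Cor. (4.5) (Hasse norm theorem for cyclic extensions). [NeukirchANT1999]

## Provenance

Lane `lit-hodgefound`, seat `literature-prover-lit-hodgefound-skel-3-g27-0` (row A3-G43, FILE 1).
-/

set_option autoImplicit false

noncomputable section

open NumberField NumberField.InfinitePlace IsDedekindDomain

namespace Literature.NumberTheory.NumberFields

open Literature.NumberTheory.QuadraticForms

variable {L : Type} [Field L] [NumberField L] [IsCMField L]

/-! ## §1. The norm form of `L/L⁺`: `N(x + yα) = x² - θy²` -/

section NormForm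

/-- `(x + yα) · ῑ(x + yα) = x² - θ y²` for `x, y ∈ L⁺`, `ᾱ = -α`, `α² = θ`. [cite: MilneCM2006, Ch. II §9, proof of Lemma 9.14 (p. 79)] -/
theorem IsCMField.add_mul_mul_complexConj_add_mul {α : L} (hα : IsCMField.complexConj L α = -α)
    {θ : maximalRealSubfield L} (hθ : α ^ 2 = algebraMap (maximalRealSubfield L) L θ) (x y : maximalRealSubfield L) :
    (algebraMap (maximalRealSubfield L) L x + algebraMap (maximalRealSubfield L) L y * α) *
        IsCMField.complexConj L
          (algebraMap (maximalRealSubfield L) L x + algebraMap (maximalRealSubfield L) L y * α) =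
      algebraMap (maximalRealSubfield L) L (x ^ 2 - θ * y ^ 2) := by
  rw [map_add, map_mul, AlgEquiv.commutes, AlgEquiv.commutes, hα, map_sub, map_mul, map_pow, map_pow, ← hθ]
  ring

/-- Every `e ∈ L` is `x + yα` with `x = (e + ē)/2`, `y = (e - ē)/(2α)` in `L⁺` (`α ≠ 0`, `ᾱ = -α`): `E = F ⊕ Fα` for a
CM field `E = F[√a]` over its largest real subfield («Equivalently, `E = F[√a]` with `F` a totally real number field and `a` a
totally negative element of `F`»). [cite: Milne2007FundamentalCM, §1.1 («CM-fields»: E = F[√a])] -/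
theorem IsCMField.exists_eq_add_mul {α : L} (hα : IsCMField.complexConj L α = -α) (hα0 : α ≠ 0) (e : L) :
    ∃ x y : maximalRealSubfield L,
      e = algebraMap (maximalRealSubfield L) L x + algebraMap (maximalRealSubfield L) L y * α := by
  have hx : (e + IsCMField.complexConj L e) / 2 ∈ maximalRealSubfield L := by
    rw [← IsCMField.complexConj_eq_self_iff, map_div₀, map_add, IsCMField.complexConj_apply_apply, map_ofNat,
      add_comm]
  have hy : (e - IsCMField.complexConj L e) / (2 * α) ∈ maximalRealSubfield L := by
    rw [← IsCMField.complexConj_eq_self_iff, map_div₀, map_sub, IsCMField.complexConj_apply_apply, map_mul,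
      map_ofNat, hα, mul_neg, div_neg, ← neg_div, neg_sub]
  refine ⟨⟨_, hx⟩, ⟨_, hy⟩, ?_⟩
  change e = (e + IsCMField.complexConj L e) / 2 + (e - IsCMField.complexConj L e) / (2 * α) * α
  field_simp
  ring

/-- **`b ∈ L⁺` is a norm from `L` — `b = e · ē` for some `e ∈ L` — iff `x² - θy² = b` is soluble in `L⁺`.**
[cite: MilneCM2006, Ch. II §9, proof of Lemma 9.14 (p. 79)] [cite: Omeara1963, §63B (63:10)] -/
theorem IsCMField.exists_eq_mul_complexConj_iff_exists_sq_sub_mul_sq {α : L} (hα : IsCMField.complexConj L α = -α)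
    (hα0 : α ≠ 0) {θ : maximalRealSubfield L} (hθ : α ^ 2 = algebraMap (maximalRealSubfield L) L θ)
    (b : maximalRealSubfield L) :
    (∃ e : L, algebraMap (maximalRealSubfield L) L b = e * IsCMField.complexConj L e) ↔
      ∃ x y : maximalRealSubfield L, x ^ 2 - θ * y ^ 2 = b := by
  constructor
  · rintro ⟨e, he⟩
    obtain ⟨x, y, rfl⟩ := IsCMField.exists_eq_add_mul hα hα0 e
    rw [IsCMField.add_mul_mul_complexConj_add_mul hα hθ] at he
    exact ⟨x, y, ((algebraMap (maximalRealSubfield L) L).injective he).symm⟩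
  · rintro ⟨x, y, h⟩
    exact ⟨_, by rw [IsCMField.add_mul_mul_complexConj_add_mul hα hθ x y, h]⟩

/-- The same in Hilbert-symbol form: for `b ≠ 0`, `b = e · ē` for some `e ∈ L` iff `(θ, b)_{L⁺} = 1`.
[cite: Omeara1963, §63B (63:10)] -/
theorem IsCMField.exists_eq_mul_complexConj_iff_hilbertSymbol_eq_one {α : L}
    (hα : IsCMField.complexConj L α = -α) (hα0 : α ≠ 0) {θ : maximalRealSubfield L}
    (hθ : α ^ 2 = algebraMap (maximalRealSubfield L) L θ) {b : maximalRealSubfield L} (hb0 : b ≠ 0) :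
    (∃ e : L, algebraMap (maximalRealSubfield L) L b = e * IsCMField.complexConj L e) ↔
      hilbertSymbol (maximalRealSubfield L) θ b = 1 := by
  have hθ0 : (θ : maximalRealSubfield L) ≠ 0 := by
    rintro rfl
    exact not_isSquare_of_sq_eq hα hα0 hθ IsSquare.zero
  rw [hilbertSymbol_eq_one_iff_exists_norm hθ0 hb0]
  exact IsCMField.exists_eq_mul_complexConj_iff_exists_sq_sub_mul_sq hα hα0 hθ b

end NormForm

/-! ## §2. The Hasse-norm step -/

section Hasse

/-- At a real place `v` of `L⁺` the local condition is positivity: `θ <_v 0` (`θ = α²`, `ᾱ = -α`, `α ≠ 0`), so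
`(θ, b)_{L⁺_v} = 1 ↔ 0 < σ_v(b)` («being a totally positive element of `F`, `ac` is a local norm from `E` at the
infinite primes»). [cite: MilneCM2006, Ch. II §9, proof of Lemma 9.14 (p. 79)] -/
theorem IsCMField.hilbertSymbol_completion_eq_one_iff_pos {α : L} (hα : IsCMField.complexConj L α = -α)
    (hα0 : α ≠ 0) {θ : maximalRealSubfield L} (hθ : α ^ 2 = algebraMap (maximalRealSubfield L) L θ)
    (v : InfinitePlace (maximalRealSubfield L)) (b : maximalRealSubfield L) :
    hilbertSymbol v.Completion (algebraMap (maximalRealSubfield L) _ (θ : maximalRealSubfield L))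
        (algebraMap (maximalRealSubfield L) _ b) = 1 ↔
      0 < embedding_of_isReal (IsTotallyReal.isReal v) b := by
  rw [hilbertSymbol_completion_eq_one_iff_of_isReal (IsTotallyReal.isReal v)]
  exact ⟨fun h => h.resolve_left (embedding_lt_zero_of_sq_eq hα hα0 hθ v _).not_gt, Or.inr⟩

/-- **THE HASSE-NORM STEP (Milne CM, proof of Lemma 9.14; Milne 2007, proof of Thm. 3.10 / Lemma 3.12): for a CM field
`L` with maximal totally real subfield `L⁺`, `L = L⁺(α)`, `ᾱ = -α ≠ 0`, `α² = θ`, an element `b ∈ L⁺` which is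
positive at every real place of `L⁺` («totally positive … a local norm from `E` at the infinite primes») and for which
`x² - θy² = b` is soluble in `L⁺_v` for every finite prime `v` («a local norm at the finite primes») is a norm from `L`:
`b = e · ē` for some `e ∈ L`** («Therefore we can write `ac = e · ē` for some `e ∈ E^×`»).  PROOF: Hasse's norm theorem
for the quadratic extension `L⁺(√θ)/L⁺` (the tree's `hilbertSymbol_eq_one_of_forall_completions_holds`, O'Meara 65:23)
and §1. [cite: MilneCM2006, Ch. II §9, proof of Lemma 9.14 (p. 79)] [cite: Milne2007FundamentalCM, §3.4, proof of Thm. 3.10 (after Lemma 3.12)]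
[cite: Omeara1963, §65D Thm. 65:23] [cite: NeukirchANT1999, Ch. VI §4 Cor. (4.5)] -/
theorem IsCMField.exists_eq_mul_complexConj_of_forall_isLocalNorm {α : L} (hα : IsCMField.complexConj L α = -α)
    (hα0 : α ≠ 0) {θ : maximalRealSubfield L} (hθ : α ^ 2 = algebraMap (maximalRealSubfield L) L θ)
    {b : maximalRealSubfield L}
    (hpos : ∀ v : InfinitePlace (maximalRealSubfield L), 0 < embedding_of_isReal (IsTotallyReal.isReal v) b)
    (hfin : ∀ v : HeightOneSpectrum (𝓞 (maximalRealSubfield L)),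
      ∃ x y : v.adicCompletion (maximalRealSubfield L),
        x ^ 2 - algebraMap (maximalRealSubfield L) _ (θ : maximalRealSubfield L) * y ^ 2 =
          algebraMap (maximalRealSubfield L) _ b) :
    ∃ e : L, algebraMap (maximalRealSubfield L) L b = e * IsCMField.complexConj L e := by
  have hθsq : ¬ IsSquare (θ : maximalRealSubfield L) := not_isSquare_of_sq_eq hα hα0 hθ
  have hθ0 : (θ : maximalRealSubfield L) ≠ 0 := by
    rintro rfl
    exact hθsq IsSquare.zero
  have hb0 : b ≠ 0 := by
    obtain ⟨v⟩ : Nonempty (InfinitePlace (maximalRealSubfield L)) := inferInstance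
    intro h
    have := hpos v
    rw [h, map_zero] at this
    exact lt_irrefl _ this
  have hH := Automorphic.hilbertSymbol_eq_one_of_forall_completions_holds (maximalRealSubfield L)
    (θ : maximalRealSubfield L) b hθsq hb0 ?_ ?_
  · exact (IsCMField.exists_eq_mul_complexConj_iff_hilbertSymbol_eq_one hα hα0 hθ hb0).2 hH
  · intro v
    haveI : CharZero (v.adicCompletion (maximalRealSubfield L)) :=
      charZero_of_injective_algebraMap (algebraMap (maximalRealSubfield L) _).injective
    rw [hilbertSymbol_eq_one_iff_exists_norm ((map_ne_zero _).2 hθ0) ((map_ne_zero _).2 hb0)]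
    exact hfin v
  · intro w
    exact (IsCMField.hilbertSymbol_completion_eq_one_iff_pos hα hα0 hθ w b).2 (hpos w)

/-- The same with «totally positive» in the elementary form `∀ φ : L⁺ →+* ℝ, 0 < φ b`.
[cite: MilneCM2006, Ch. II §9, proof of Lemma 9.14 (p. 79)] [cite: Omeara1963, §65D Thm. 65:23] -/
theorem IsCMField.exists_eq_mul_complexConj_of_totallyPositive_of_forall_isLocalNorm {α : L}
    (hα : IsCMField.complexConj L α = -α) (hα0 : α ≠ 0) {θ : maximalRealSubfield L}
    (hθ : α ^ 2 = algebraMap (maximalRealSubfield L) L θ) {b : maximalRealSubfield L}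
    (hpos : ∀ φ : maximalRealSubfield L →+* ℝ, 0 < φ b)
    (hfin : ∀ v : HeightOneSpectrum (𝓞 (maximalRealSubfield L)),
      ∃ x y : v.adicCompletion (maximalRealSubfield L),
        x ^ 2 - algebraMap (maximalRealSubfield L) _ (θ : maximalRealSubfield L) * y ^ 2 =
          algebraMap (maximalRealSubfield L) _ b) :
    ∃ e : L, algebraMap (maximalRealSubfield L) L b = e * IsCMField.complexConj L e :=
  IsCMField.exists_eq_mul_complexConj_of_forall_isLocalNorm hα hα0 hθ (fun _ => hpos _) hfin

/-- The same with the local conditions as Hilbert symbols: `(θ, b)_{L⁺_v} = 1` at every finite and every infinite place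
of `L⁺` implies `b = e · ē`. [cite: Omeara1963, §65D Thm. 65:23] [cite: VignerasLNM800, Ch. III §3 Cor. 3.4]
[cite: MilneCM2006, Ch. II §9, proof of Lemma 9.14 (p. 79)] -/
theorem IsCMField.exists_eq_mul_complexConj_of_forall_hilbertSymbol_eq_one {α : L}
    (hα : IsCMField.complexConj L α = -α) (hα0 : α ≠ 0) {θ : maximalRealSubfield L}
    (hθ : α ^ 2 = algebraMap (maximalRealSubfield L) L θ) {b : maximalRealSubfield L} (hb0 : b ≠ 0)
    (hfin : ∀ v : HeightOneSpectrum (𝓞 (maximalRealSubfield L)),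
      hilbertSymbol (v.adicCompletion (maximalRealSubfield L))
        (algebraMap (maximalRealSubfield L) _ (θ : maximalRealSubfield L)) (algebraMap (maximalRealSubfield L) _ b) = 1)
    (hinf : ∀ w : InfinitePlace (maximalRealSubfield L),
      hilbertSymbol w.Completion (algebraMap (maximalRealSubfield L) _ (θ : maximalRealSubfield L))
        (algebraMap (maximalRealSubfield L) _ b) = 1) :
    ∃ e : L, algebraMap (maximalRealSubfield L) L b = e * IsCMField.complexConj L e :=
  (IsCMField.exists_eq_mul_complexConj_iff_hilbertSymbol_eq_one hα hα0 hθ hb0).2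
    (Automorphic.hilbertSymbol_eq_one_of_forall_completions_holds (maximalRealSubfield L) (θ : maximalRealSubfield L) b
      (not_isSquare_of_sq_eq hα hα0 hθ) hb0 hfin hinf)

/-- The HASSE-NORM STEP for `b ∈ L` with `b̄ = b` (so `b ∈ L⁺`): positive at every real place of `L⁺` and a local norm
at every finite prime of `L⁺` ⇒ `b = e · ē`, `e ∈ L`. [cite: MilneCM2006, Ch. II §9, proof of Lemma 9.14 (p. 79)]
[cite: Milne2007FundamentalCM, §3.4, proof of Thm. 3.10 (after Lemma 3.12)] -/
theorem IsCMField.exists_eq_mul_complexConj_of_forall_isLocalNorm' {α : L} (hα : IsCMField.complexConj L α = -α)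
    (hα0 : α ≠ 0) {θ : maximalRealSubfield L} (hθ : α ^ 2 = algebraMap (maximalRealSubfield L) L θ)
    {b : L} (hb : IsCMField.complexConj L b = b)
    (hpos : ∀ v : InfinitePlace (maximalRealSubfield L), 0 < embedding_of_isReal (IsTotallyReal.isReal v)
      ⟨b, (IsCMField.complexConj_eq_self_iff L b).1 hb⟩)
    (hfin : ∀ v : HeightOneSpectrum (𝓞 (maximalRealSubfield L)),
      ∃ x y : v.adicCompletion (maximalRealSubfield L),
        x ^ 2 - algebraMap (maximalRealSubfield L) _ (θ : maximalRealSubfield L) * y ^ 2 =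
          algebraMap (maximalRealSubfield L) _ (⟨b, (IsCMField.complexConj_eq_self_iff L b).1 hb⟩ : maximalRealSubfield L)) :
    ∃ e : L, b = e * IsCMField.complexConj L e :=
  IsCMField.exists_eq_mul_complexConj_of_forall_isLocalNorm hα hα0 hθ hpos hfin

end Hasse

end Literature.NumberTheory.NumberFields

end
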